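import Summits.BirchSwinnertonDyer.BirchSwinnertonDyer.Theorems.GenusKolyvaginAtTwoGenusDeepSupplyAtTwoNegDiscNarrowRamifiedInvariantPart
import Summits.BirchSwinnertonDyer.BirchSwinnertonDyer.Theorems.GenusKolyvaginAtTwoGenusPrimitiveSupplyAtTwoTwistSelmerStrictInherit
import Summits.BirchSwinnertonDyer.BirchSwinnertonDyer.Theorems.CMKolyvaginAtInertTwoRationalDescentAtTwoCount
import Summits.BirchSwinnertonDyer.BirchSwinnertonDyer.Theorems.GenusKolyvaginAtTwoEquivariantKolyvaginExactAtTwoArchimedeanSelmerLevel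
import Summits.BirchSwinnertonDyer.BirchSwinnertonDyer.Theorems.GenusKolyvaginAtTwoCasselsTateNumberField
import Literature.NumberTheory.EllipticCurves.SecondDescentShaExponentProofs
import Literature.NumberTheory.EllipticCurves.CasselsTateLocalTermLinePerp
import HarnessLib

/-!
# Route `GenusKolyvaginAtTwo`, crux 23491 `GenusDeepSupplyAtTwoNegDiscNarrow`, registered stub C‴, POSITIVE-DEPTH CELL K₄ (`#Sel₂(E) = 4`):
# THE 2-RANK OF `Ш(E/K)` ON THE K₄ CELL IS EXACTLY 2 — `dim Sel₂(E_K/K) = 3`, `Ш(E/K)[2] ≅ (ℤ/2)²`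

LEAD seat `bsd-line-gk2-p1` g22 (cell `bsd-f1-sign2`), `--supports stmt-BirchSwinnertonDyer-23491 --as helper`; sequel of
`…NegDiscNarrowRamifiedInvariantPart` (p765489).  THEOREMS ONLY (no definition, no named fact, no `sorry`).  **BSD is NOT proved by this file, no
item is closed, the registered stub C‴ is untouched.**  CONDITIONAL ONLY on the two displayed print facts of the lineage's Mazur–Rubin engine
(`poitouTate_selmerStructure_duality_real ℚ` = Milne I.4.10, `localEulerPoincareCharacteristic` = Milne I.2.8), exactly as gk2-p5's §26.

THE CELL.  `E/ℚ` globally minimal, `Δ_E < 0`, `#Sel₂(E) = 4`; `K = ℚ(√−ℓ)` imaginary quadratic (`d_K = −ℓ` odd, `ℓ` prime), Heegner for `N_E`,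
`2` split; a model `Wd` of the twin `E^{(d_K)}` with `#Sel₂(Wd) = 2` — the `#Sel₂(E) = 4` half of crux 23491's frame (Kolyvagin depth `M₀ ≥ 1`
there by PAIRCOUNT).

* §1 **`natCard_kummerRelaxed_eq_four_of_cell`** — on the cell `Sel₂(E) = Sel₂^{rel ℓ}(E)` (relaxed at the place over `ℓ`): `[relaxed : strict] =
  #E(ℚ_ℓ)[2] = 2` (X5/X11b `relIndex_kummerStrict_kummerRelaxed_singleton_eq_of_facts`, `GenusKolyTwin.natCard_twoTorsion_padic_eq_two_of_discr_eq_neg_prime`)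
  and `Sel₂(E)` is NOT strict at `ℓ` (else gk2-p4 g9's §28 gives `#Sel₂(E) ∣ #Sel₂(Wd)`, `4 ∤ 2`); hence **`#Sel₂^{rel ℓ}(E) = 4`**.
* §2 **`natCard_fixedSelmer_eq_natCard_kummerRelaxed`** — `#Sel₂(E_K/K)^{Gal(K/ℚ)} = #Sel₂^{rel ℓ}(E)` (`= 4` on the cell): by the invariant-part theorem of the prequel
  (`RamifiedDescent.mem_selmerGroup_and_conjAct_eq_iff_exists_relaxed`) the invariants are `res_K` of the `{ℓ,∞}`-relaxed group, `= Sel₂^{rel ℓ}(E)` since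
  `Δ<0` kills `∞` (`ArchVanishing`), and `res_K` is injective (`E(K)[2] = 0`).
* §3 **`natCard_selmerGroup_baseChange_eq_mul`** — `𝔽₂[Gal(K/ℚ)]`-bookkeeping: `σ−1` maps `Sel₂(E_K)` into its invariants with kernel the
  invariants, so `#Sel₂(E_K/K) = #(invariants)·k` with `k ∣ #(invariants)` (`= 4k`, `k ∣ 4` on the cell).
* §4 **`natCard_shaTorsionBy_two_baseChange_eq_four`** (both counts) — with `rank E(K) = 1` (descent count
  `2^{rk}·#E(K)[2]·#Ш[2] = #Sel₂`, Silverman X.4.2) and the Cassels–Tate SQUARE over `K` (`GenusExact.CasselsTateNumberField.isSquare_natCard_sha_torsionBy_pow`,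
  unconditional given `Ш(E_K)[2^∞]` finite): `2·#Ш[2] = 4k`, `#Ш[2] ∈ {2, 4, 8}` a square ⟹ **`#Ш(E_K/K)[2] = 4`, `#Sel₂(E_K/K) = 8`**.

READING (LEAD-BRIEF-g22 §3; the positive-depth content of C‴).  `Ш(E/K)[2^∞]` is finite with 2-rank EXACTLY 2 on the whole K₄ cell, i.e.
`≅ (ℤ/2^e)²` (Cassels–Tate `N × N`).  In Kolyvagin–McCallum structure currency (`Ш[p^∞] ≅ ⊕ (ℤ/p^{M_{i−1}−M_i})²`, McCallum 1991 Thm. 5.?; at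
`p = 2` in deep currency NOT in print) this reads `M₁ = M_∞`: **a deep witness of C‴ (`P(n) ∉ 2E(K[n])`), if it exists for ANY square-free `n`,
already exists for a SINGLE deep prime `n = ℓ₁`**; and BSD (`#Ш(E/K)[2^∞] = 4^{M₀}`, lossless §3 of gk2-p5 p763825) predicts `e = M₀`, `M₁ = 0`.
So the refuter's vacuity probe «is the single-prime form of K₄ empty BSD-side?» is answered NO on this cell; and a proof strategy for K₄ may aim at
ONE deep prime (genus form: the reduced genus Heegner point `Y_ℓ₁/2` is `2`-primitive, `GenusKoly.heegner_exists_two_zsmul_eq_derivedPoint_iff_four_dvd`).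
Nothing here proves K₄; BSD is not proved.

References: [Kramer1981] Thm. 1; [MazurRubin2010] Def. 3.1, Lemma 3.2, Prop. 3.3, Cor. 3.4 (i); [MilneADT2006] I Thm. 2.8, Lemma 3.3, Thm. 4.10, Thm. 6.13;
[SilvermanAEC2009] Thm. X.4.2, Thm. X.4.14; [Cassels1962ArithmeticIV]; [McCallumLMS1991] §5; [GrossLMS1991] §5 (5.1).
-/

set_option linter.dupNamespace false -- tree convention: `Summit.BirchSwinnertonDyer.BirchSwinnertonDyer.Theorems` (summit = sub-problem)
set_option autoImplicit false

noncomputable section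

open scoped Classical

namespace Summit.BirchSwinnertonDyer.BirchSwinnertonDyer.Theorems.GenusSupplyNarrow.KFourCell

open WeierstrassCurve NumberField IsDedekindDomain Field Function
open Literature.NumberTheory.EllipticCurves Literature.NumberTheory.GaloisRepresentations
open Literature.NumberTheory.GaloisCohomology
open Literature.Barriers.BirchSwinnertonDyer (Matsuno2009.primePlace)
open Rat.HeightOneSpectrum (primesEquiv)
open Summit.BirchSwinnertonDyer.Rank1Residual.X11b.KummerPT (kummerRelaxed kummerStrict)
open Summit.BirchSwinnertonDyer.Rank1Residual.X11b.CongruentTransfer (selmerGroup_sandwich_kummer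
  relIndex_kummerStrict_kummerRelaxed_singleton_eq_of_facts)
open Summit.BirchSwinnertonDyer.BirchSwinnertonDyer.Theorems.KolyvaginRatDescentTwo (mem_selmerGroup_kummerRelaxed_singleton_iff
  mem_selmerGroup_kummerStrict_singleton_iff)
open Summit.BirchSwinnertonDyer.BirchSwinnertonDyer.Theorems.GenusKolyTwistLocal (natCard_selmerGroup_dvd_twist_of_places_of_forall_localization_eq_zero
  twist_place_menu_finite_rat twist_place_menu_infinite_rat natCard_ker_nsmul_adicCompletion_eq_padic mem_torsionLocalKer_iff_localization_eq_zero_rat)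

/-! ## §0 Small bookkeeping -/

section Prelim

/-- The place of `ℚ` produced by `primesEquiv.symm` is `Matsuno2009.primePlace ℓ`. [folklore] -/
theorem primePlace_eq_of_primesEquiv_eq {ℓ : ℕ} (hℓ : ℓ.Prime) {v₀ : HeightOneSpectrum (𝓞 ℚ)}
    (hv₀ : ((primesEquiv v₀ : Nat.Primes) : ℕ) = ℓ) : Matsuno2009.primePlace ℓ = v₀ := by
  have hℓv₀ : (ℓ : 𝓞 ℚ) ∈ v₀.asIdeal := by
    rw [← hv₀]
    exact Rat.HeightOneSpectrum.natCast_natGenerator_mem v₀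
  exact Literature.NumberTheory.EllipticCurves.HeightOneSpectrum.eq_of_natCast_mem_rat hℓ
    (Literature.Barriers.BirchSwinnertonDyer.Matsuno2009.natCast_mem_primePlace hℓ) hℓv₀

/-- `#E(ℚ_{v₀})[2] = 2` at the place over the prime `ℓ` with `d_K = −ℓ`, on `Δ < 0` (gk2-p5's root count, transported to the tree's completion).
[cite: MazurRubin2010, Lemma 2.11] [cite: SilvermanAEC2009, VII.§3] -/
theorem natCard_ker_two_adicCompletion_eq_two (W : WeierstrassCurve ℚ) [W.IsElliptic] [W.IsGloballyMinimal] {K : Type} [Field K]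
    [NumberField K] (hK : IsImaginaryQuadratic K) (hodd : Odd (discr K)) (hH : SatisfiesHeegnerHypothesis (W.conductorNorm ℤ) K)
    (hΔ : W.Δ < 0) {ℓ : ℕ} [Fact ℓ.Prime] (hd : discr K = -(ℓ : ℤ)) {v₀ : HeightOneSpectrum (𝓞 ℚ)}
    (hv₀ : ((primesEquiv v₀ : Nat.Primes) : ℕ) = ℓ) :
    Nat.card (nsmulAddMonoidHom 2 : (W.baseChange (v₀.adicCompletion ℚ)).toAffine.Point →+ _).ker = 2 := by
  rw [natCard_ker_nsmul_adicCompletion_eq_padic W v₀ 2]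
  subst hv₀
  exact GenusKolyTwin.natCard_twoTorsion_padic_eq_two_of_discr_eq_neg_prime W hK hodd hH hd hΔ

/-- In `H¹(·, E[2])` every class is its own negative. [folklore] -/
theorem neg_eq_self_galH1Torsion_two {F : Type} [Field F] [NumberField F] (V : WeierstrassCurve F) (z : galH1Torsion V ((2 : ℕ) : ℤ)) :
    -z = z := by
  have h2 : ((2 : ℕ) : ℤ) • z = 0 := zsmul_discreteH1_torsion ((2 : ℕ) : ℤ) z
  have h2' : z + z = 0 := by
    rw [← two_zsmul]
    exact_mod_cast h2
  exact (neg_eq_of_add_eq_zero_left h2').symm ▸ rfl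

end Prelim

/-! ## §1 On the cell, `Sel₂(E)` is the `ℓ`-RELAXED Selmer group: `#Sel₂^{rel ℓ}(E) = 4` -/

section Relaxed

variable (W : WeierstrassCurve ℚ) [W.IsElliptic] [W.IsGloballyMinimal] {K : Type} [Field K] [NumberField K]

/-- **`Sel₂(E) = H¹_{𝓚^{ℓ}}(ℚ, E[2])` and `#H¹_{𝓚^{ℓ}} = 4` on the K₄ cell.**  With `v₀` the place over `ℓ`: `𝓚_{v₀} ≤ Sel₂(E) ≤ 𝓚^{v₀}`
(sandwich), `[𝓚^{v₀} : 𝓚_{v₀}] = #E(ℚ_ℓ)[2]·#(ℤ_ℓ/2) = 2·1` (Poitou–Tate + local Euler characteristic, the displayed print hypotheses), and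
`Sel₂(E) ≠ 𝓚_{v₀}`: a strict `Sel₂(E)` would be inherited by the twin (`#Sel₂(E) ∣ #Sel₂(Wd)`, gk2-p4 g9 §28, unconditional), but `4 ∤ 2`.
Hence `Sel₂(E) = 𝓚^{v₀}` and `#𝓚^{v₀} = 4`.  [cite: MazurRubin2010, Lemma 3.2, Prop. 3.3, Cor. 3.4 (i) (arXiv:0904.3709 p. 10)]
[cite: MilneADT2006, Ch. I, Thm. 2.8 and Thm. 4.10] -/
theorem natCard_kummerRelaxed_eq_four_of_cell
    (hPT : poitouTate_selmerStructure_duality_real ℚ)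
    (hEP : ∀ v : HeightOneSpectrum (𝓞 ℚ), localEulerPoincareCharacteristic (v.adicCompletion ℚ))
    (hΔ : W.Δ < 0) (hK : IsImaginaryQuadratic K) (hodd : Odd (discr K))
    (hH : SatisfiesHeegnerHypothesis (W.conductorNorm ℤ) K) (h2K : ((Ideal.span {(2 : ℤ)}).primesOver (𝓞 K)).ncard = 2)
    {ℓ : ℕ} [Fact ℓ.Prime] (hd : discr K = -(ℓ : ℤ)) (h4 : Nat.card (W.selmerGroup 2) = 4)
    (Wd : WeierstrassCurve ℚ) [Wd.IsElliptic] (hWd : ∃ C : VariableChange ℚ, C • W.quadraticTwist (discr K : ℚ) = Wd)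
    (hSel : Nat.card (Wd.selmerGroup 2) = 2) {v₀ : HeightOneSpectrum (𝓞 ℚ)} (hv₀ : ((primesEquiv v₀ : Nat.Primes) : ℕ) = ℓ) :
    (W.kummerSelmerStructure ((2 : ℕ) : ℤ)).selmerGroup = (kummerRelaxed W 2 {(Sum.inr v₀ : Place ℚ)}).selmerGroup ∧
      Nat.card ((kummerRelaxed W 2 {(Sum.inr v₀ : Place ℚ)}).selmerGroup) = 4 := by
  haveI : Fact (Nat.Prime 2) := ⟨Nat.prime_two⟩
  have hℓ : ℓ.Prime := Fact.out
  have hℓv₀ : (ℓ : 𝓞 ℚ) ∈ v₀.asIdeal := by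
    rw [← hv₀]
    exact Rat.HeightOneSpectrum.natCast_natGenerator_mem v₀
  obtain ⟨hℓ2, -, -⟩ := GenusKolyTwin.prime_discr_facts W hK hodd hH hℓ hd
  have h2v₀ : ((2 : ℕ) : 𝓞 ℚ) ∉ v₀.asIdeal :=
    GenusKolyTwistingPrime.natCast_not_mem_of_not_dvd hℓ hℓv₀ fun h ↦
      hℓ2 ((Nat.prime_dvd_prime_iff_eq hℓ Nat.prime_two).mp h)
  obtain ⟨C, hC⟩ := hWd
  have hd0 : (discr K : ℚ) ≠ 0 := by
    rw [hd]
    push_cast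
    exact neg_ne_zero.mpr (by exact_mod_cast hℓ.ne_zero)
  -- the three groups, all inside `H¹(ℚ, E[2])` in the Selmer-structure currency
  have hS : W.selmerGroup ((2 : ℕ) : ℤ) = (W.kummerSelmerStructure ((2 : ℕ) : ℤ)).selmerGroup :=
    selmerGroup_eq_selmerGroup_kummerSelmerStructure W 2
  have h4' : Nat.card (W.selmerGroup ((2 : ℕ) : ℤ)) = 4 := h4
  have h4S : Nat.card ((W.kummerSelmerStructure ((2 : ℕ) : ℤ)).selmerGroup) = 4 := hS ▸ h4'
  -- sandwich `𝓚_{v₀} ≤ Sel ≤ 𝓚^{v₀}`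
  obtain ⟨hle₁, hle₂⟩ := selmerGroup_sandwich_kummer W 2 ({(Sum.inr v₀ : Place ℚ)} : Finset (Place ℚ))
  -- the index `[𝓚^{v₀} : 𝓚_{v₀}] = 2`
  have hidx : (kummerStrict W 2 {(Sum.inr v₀ : Place ℚ)}).selmerGroup.relIndex
      (kummerRelaxed W 2 {(Sum.inr v₀ : Place ℚ)}).selmerGroup = 2 := by
    have h := relIndex_kummerStrict_kummerRelaxed_singleton_eq_of_facts (W := W) (p := 2) hPT hEP v₀
    rw [natCard_ker_two_adicCompletion_eq_two W hK hodd hH hΔ hd hv₀,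
      Literature.NumberTheory.EllipticCurves.natCard_adicCompletionIntegers_quotient_span_natCast_eq_one v₀ h2v₀, mul_one] at h
    exact h
  -- split the index along the sandwich
  have hmul : (kummerStrict W 2 {(Sum.inr v₀ : Place ℚ)}).selmerGroup.relIndex (W.kummerSelmerStructure ((2 : ℕ) : ℤ)).selmerGroup *
      (W.kummerSelmerStructure ((2 : ℕ) : ℤ)).selmerGroup.relIndex (kummerRelaxed W 2 {(Sum.inr v₀ : Place ℚ)}).selmerGroup = 2 := by
    have h := AddSubgroup.relIndex_mul_relIndex _ _ _ hle₁ hle₂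
    rw [hidx] at h
    exact h
  -- `Sel` is not strict at `v₀`: else `#Sel₂(E) ∣ #Sel₂(Wd)`, i.e. `4 ∣ 2`
  have hns : (kummerStrict W 2 {(Sum.inr v₀ : Place ℚ)}).selmerGroup.relIndex (W.kummerSelmerStructure ((2 : ℕ) : ℤ)).selmerGroup ≠ 1 := by
    intro h1
    have hle : (W.kummerSelmerStructure ((2 : ℕ) : ℤ)).selmerGroup ≤ (kummerStrict W 2 {(Sum.inr v₀ : Place ℚ)}).selmerGroup :=
      AddSubgroup.relIndex_eq_one.mp h1
    have hstrict : ∀ c ∈ (W.kummerSelmerStructure ((2 : ℕ) : ℤ)).selmerGroup,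
        galoisCohomology.localization (W.torsionGaloisModule ((2 : ℕ) : ℤ)) (Sum.inr v₀) 1 c = 0 := by
      intro c hc
      have hc' := ((mem_selmerGroup_kummerStrict_singleton_iff W v₀ c).mp (hle hc)).2
      exact (mem_torsionLocalKer_iff_localization_eq_zero_rat W v₀ c).mp hc'
    have hdvd := natCard_selmerGroup_dvd_twist_of_places_of_forall_localization_eq_zero W hd0 hC v₀
      (twist_place_menu_finite_rat W hK.1 hH h2K hℓ hd hℓv₀ hC) (twist_place_menu_infinite_rat W hΔ hd0 hC) hstrict
    have hSel' : Nat.card (Wd.selmerGroup ((2 : ℕ) : ℤ)) = 2 := hSel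
    rw [h4', hSel'] at hdvd
    omega
  -- so `[𝓚^{v₀} : Sel] = 1`, i.e. `Sel = 𝓚^{v₀}`
  have hone : (W.kummerSelmerStructure ((2 : ℕ) : ℤ)).selmerGroup.relIndex (kummerRelaxed W 2 {(Sum.inr v₀ : Place ℚ)}).selmerGroup = 1 := by
    have h2 : (kummerStrict W 2 {(Sum.inr v₀ : Place ℚ)}).selmerGroup.relIndex (W.kummerSelmerStructure ((2 : ℕ) : ℤ)).selmerGroup ∣ 2 :=
      Dvd.intro _ hmul
    rcases (Nat.dvd_prime Nat.prime_two).mp h2 with h | h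
    · exact absurd h hns
    · rw [h] at hmul
      omega
  have heq : (W.kummerSelmerStructure ((2 : ℕ) : ℤ)).selmerGroup = (kummerRelaxed W 2 {(Sum.inr v₀ : Place ℚ)}).selmerGroup :=
    le_antisymm hle₂ (AddSubgroup.relIndex_eq_one.mp hone)
  exact ⟨heq, heq ▸ h4S⟩

end Relaxed

/-! ## §2 The `Gal(K/ℚ)`-invariants of `Sel₂(E_K/K)` on the cell have order 4 -/

section Invariants

variable (W : WeierstrassCurve ℚ) [W.IsElliptic] [W.IsGloballyMinimal] (K : Type) [Field K] [NumberField K]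

/-- **`#Sel₂(E_K/K)^{Gal(K/ℚ)} = #Sel₂^{rel ℓ}(E)`** on the prime-Heegner-field frame with `Δ<0`, `E(K)[2] = 0`: for any non-trivial
`σ₀ ∈ Aut(K/ℚ)`, the `σ₀`-fixed `2`-Selmer classes of `E_K` are in bijection with the `ℓ`-relaxed Selmer group of `E` via `res_K`
(prequel §5 `RamifiedDescent.mem_selmerGroup_and_conjAct_eq_iff_exists_relaxed`; `Δ<0` makes the real condition empty,
`ArchVanishing.mem_selmerLocalKer_infinitePlace_of_Δ_neg`; `res_K` injective, `EigenClassesFinite.resTorsion_injective_of_noTorsion`).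
[cite: Kramer1981, Thm. 1 (proof)] [cite: GrossLMS1991, §5 (5.1)] -/
theorem natCard_fixedSelmer_eq_natCard_kummerRelaxed (hK : IsImaginaryQuadratic K) (hΔ : W.Δ < 0)
    (hH : SatisfiesHeegnerHypothesis (W.conductorNorm ℤ) K) (h2K : ((Ideal.span {(2 : ℤ)}).primesOver (𝓞 K)).ncard = 2)
    (hodd : Odd (discr K)) {ℓ : ℕ} [Fact ℓ.Prime] (hd : discr K = -(ℓ : ℤ))
    (hL : ∀ P : (W.baseChange K).toAffine.Point, ((2 : ℕ) : ℤ) • P = 0 → P = 0)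
    {σ₀ : K ≃ₐ[ℚ] K} (hσ₀ : σ₀ ≠ 1) {v₀ : HeightOneSpectrum (𝓞 ℚ)} (hv₀ : ((primesEquiv v₀ : Nat.Primes) : ℕ) = ℓ) :
    Nat.card {m : galH1Torsion (W.baseChange K) ((2 : ℕ) : ℤ) //
        m ∈ selmerGroup (W.baseChange K) ((2 : ℕ) : ℤ) ∧ conjAct W σ₀ ((2 : ℕ) : ℤ) m = m} =
      Nat.card ((kummerRelaxed W 2 {(Sum.inr v₀ : Place ℚ)}).selmerGroup) := by
  have h2 : Module.finrank ℚ K = 2 := hK.1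
  have hℓ : ℓ.Prime := Fact.out
  have hpp : Matsuno2009.primePlace ℓ = v₀ := primePlace_eq_of_primesEquiv_eq hℓ hv₀
  have hℓv₀ : (ℓ : 𝓞 ℚ) ∈ v₀.asIdeal := by
    rw [← hv₀]
    exact Rat.HeightOneSpectrum.natCast_natGenerator_mem v₀
  obtain ⟨hℓ2, hℓN, -⟩ := GenusKolyTwin.prime_discr_facts W hK hodd hH hℓ hd
  have h2v₀ : ((2 : ℕ) : 𝓞 ℚ) ∉ v₀.asIdeal :=
    GenusKolyTwistingPrime.natCast_not_mem_of_not_dvd hℓ hℓv₀ fun h ↦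
      hℓ2 ((Nat.prime_dvd_prime_iff_eq hℓ Nat.prime_two).mp h)
  have hgood : W.HasGoodReductionAt v₀ := by
    by_contra h
    exact hℓN (hv₀ ▸ (W.dvd_conductorNorm_iff v₀).mpr h)
  obtain ⟨θ, hθ, hc⟩ := Literature.NumberTheory.EllipticCurves.exists_sq_eq_discr_not_mem_range K h2
  have hinj := GenusExact.EigenClassesFinite.resTorsion_injective_of_noTorsion W K h2 hθ hc ((2 : ℕ) : ℤ) hL
  -- the bijection `x ↦ res_K x`
  symm
  refine Nat.card_congr (Equiv.ofBijective
    (fun x : (kummerRelaxed W 2 {(Sum.inr v₀ : Place ℚ)}).selmerGroup ↦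
      (⟨resTorsion W K ((2 : ℕ) : ℤ) x.1, ?_⟩ : {m : galH1Torsion (W.baseChange K) ((2 : ℕ) : ℤ) //
        m ∈ selmerGroup (W.baseChange K) ((2 : ℕ) : ℤ) ∧ conjAct W σ₀ ((2 : ℕ) : ℤ) m = m}))
    ⟨fun x y hxy ↦ Subtype.ext (hinj (congrArg Subtype.val hxy)), fun m ↦ ?_⟩)
  · -- `res_K x` is a fixed Selmer class
    have hx := ((mem_selmerGroup_kummerRelaxed_singleton_iff W v₀ x.1).mp x.2).1
    refine (RamifiedDescent.mem_selmerGroup_and_conjAct_eq_iff_exists_relaxed W K hK hH h2K hodd hℓ hd (hpp ▸ h2v₀) (hpp ▸ hgood)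
      hL hσ₀ _).mpr ⟨x.1, fun v hv ↦ hx v (by rwa [hpp] at hv), rfl⟩
  · -- every fixed Selmer class is `res_K` of a relaxed class
    obtain ⟨x, hx, hxm⟩ := (RamifiedDescent.mem_selmerGroup_and_conjAct_eq_iff_exists_relaxed W K hK hH h2K hodd hℓ hd
      (hpp ▸ h2v₀) (hpp ▸ hgood) hL hσ₀ m.1).mp m.2
    refine ⟨⟨x, (mem_selmerGroup_kummerRelaxed_singleton_iff W v₀ x).mpr ⟨fun v hv ↦ hx v (by rwa [hpp]), fun w ↦
      GenusExact.ArchVanishing.mem_selmerLocalKer_infinitePlace_of_Δ_neg W w hΔ _ x⟩⟩, Subtype.ext hxm⟩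

end Invariants

/-! ## §3 `𝔽₂[Gal(K/ℚ)]`-bookkeeping: `#Sel₂(E_K/K) = #(invariants) · k` with `k ∣ #(invariants)` -/

section Count

variable (W : WeierstrassCurve ℚ) (K : Type) [Field K] [NumberField K]

/-- **`#Sel₂(E_K/K) = #Sel₂(E_K/K)^{σ₀} · k` with `k ∣ #Sel₂(E_K/K)^{σ₀}`** for an involution `σ₀` of `K` over which `Sel₂(E_K/K)` is
stable (all infinite places of `K` complex): the map `m ↦ σ₀m − m` on `Sel₂(E_K)` has kernel the invariants and — since `σ₀² = 1` and
`H¹(K, E[2])` is killed by `2` — image inside the invariants.  Pure group bookkeeping (first isomorphism theorem + Lagrange).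
[cite: Kramer1981, Thm. 1 (proof)] [cite: GrossLMS1991, §5 (5.1)] -/
theorem natCard_selmerGroup_baseChange_eq_mul (hKc : ∀ w : InfinitePlace K, w.IsComplex) {σ₀ : K ≃ₐ[ℚ] K}
    (hσσ : σ₀ * σ₀ = 1) :
    ∃ k : ℕ, Nat.card (selmerGroup (W.baseChange K) ((2 : ℕ) : ℤ)) =
        Nat.card {m : galH1Torsion (W.baseChange K) ((2 : ℕ) : ℤ) //
          m ∈ selmerGroup (W.baseChange K) ((2 : ℕ) : ℤ) ∧ conjAct W σ₀ ((2 : ℕ) : ℤ) m = m} * k ∧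
      k ∣ Nat.card {m : galH1Torsion (W.baseChange K) ((2 : ℕ) : ℤ) //
          m ∈ selmerGroup (W.baseChange K) ((2 : ℕ) : ℤ) ∧ conjAct W σ₀ ((2 : ℕ) : ℤ) m = m} := by
  set M := selmerGroup (W.baseChange K) ((2 : ℕ) : ℤ) with hM
  set σ := conjAct W σ₀ ((2 : ℕ) : ℤ) with hσdef
  -- `φ = (σ − 1)|_M`
  let φ : M →+ galH1Torsion (W.baseChange K) ((2 : ℕ) : ℤ) := σ.comp M.subtype - M.subtype
  have hφ : ∀ m : M, φ m = σ m.1 - m.1 := fun m ↦ rfl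
  -- the fixed classes, as a subtype, are in bijection with `ker φ`
  have hker : Nat.card φ.ker = Nat.card {m : galH1Torsion (W.baseChange K) ((2 : ℕ) : ℤ) // m ∈ M ∧ σ m = m} := by
    refine Nat.card_congr
      { toFun := fun x ↦ ⟨x.1.1, x.1.2, sub_eq_zero.mp (by rw [← hφ]; exact x.2)⟩
        invFun := fun y ↦ ⟨⟨y.1, y.2.1⟩, by
          change φ _ = 0
          rw [hφ]; exact sub_eq_zero.mpr y.2.2⟩
        left_inv := fun x ↦ by ext; rfl
        right_inv := fun y ↦ by ext; rfl }
  -- the image lies in the fixed classes (viewed in the ambient group)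
  have hrange : φ.range ≤ (φ.ker).map (M.subtype) := by
    rintro y ⟨m, rfl⟩
    have hσm : σ m.1 ∈ M := conjAct_mem_selmerGroup W hKc σ₀ _ m.2
    have hyM : σ m.1 - m.1 ∈ M := M.sub_mem hσm m.2
    have hfix : σ (σ m.1 - m.1) = σ m.1 - m.1 := by
      rw [map_sub, hσdef, conjAct_conjAct_of_mul_self W hσσ, ← hσdef, ← neg_sub, neg_eq_self_galH1Torsion_two]
    refine AddSubgroup.mem_map.mpr ⟨⟨σ m.1 - m.1, hyM⟩, ?_, rfl⟩
    change φ _ = 0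
    rw [hφ]
    exact sub_eq_zero.mpr hfix
  -- first isomorphism theorem + Lagrange
  have hcard : Nat.card M = Nat.card φ.ker * Nat.card φ.range := by
    rw [φ.ker.card_eq_card_quotient_mul_card_addSubgroup, mul_comm,
      Nat.card_congr (QuotientAddGroup.quotientKerEquivRange φ).toEquiv]
  have hdvd : Nat.card φ.range ∣ Nat.card φ.ker := by
    have h1 : Nat.card φ.range ∣ Nat.card ((φ.ker).map M.subtype) := AddSubgroup.card_dvd_of_le hrange
    rwa [AddSubgroup.card_map_of_injective M.subtype_injective] at h1
  exact ⟨Nat.card φ.range, by rw [← hker]; exact hcard, by rw [← hker]; exact hdvd⟩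

end Count

/-! ## §4 The K₄ cell: `#Ш(E_K/K)[2] = 4`, `#Sel₂(E_K/K) = 8` -/

section Cell

variable (W : WeierstrassCurve ℚ) [W.IsElliptic] [W.IsGloballyMinimal] (K : Type) [Field K] [NumberField K]

/-- **THE 2-RANK OF `Ш(E/K)` ON THE K₄ CELL IS 2: `#Ш(E_K/K)[2] = 4` and `#Sel₂(E_K/K) = 8`.**  HYPOTHESES (the `#Sel₂(E) = 4` half of crux
23491's frame, read over `K`): `E/ℚ` globally minimal, `Δ_E < 0`, `#Sel₂(E) = 4`; `K` imaginary quadratic, `d_K = −ℓ` odd (`ℓ` prime), Heegner for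
`N_E`, `2` split; `Wd` an elliptic model of `E^{(d_K)}` with `#Sel₂(Wd) = 2`; `E(K)[2] = 0` (`hL`; from `ρ̄_{E,2}` onto); `rank E(K) = 1` (`hrk`;
on the frame: `rank E(ℚ) = 0` by `r_an = 0` + GZK, `rank Wd(ℚ) = 1` by the Heegner point); `Ш(E_K/K)[2^∞]` finite (exactness / U_T); and the two
print facts `hPT`, `hEP` of the Mazur–Rubin engine.  PROOF: §1–§3 give `#Sel₂(E_K) = 4k`, `k ∣ 4`; the descent count `2^{rk}·#E(K)[2]·#Ш[2] = #Sel₂`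
(Silverman X.4.2) gives `#Sel₂(E_K) = 2·#Ш(E_K)[2]`; Cassels–Tate over `K` (unconditional in the tree) makes `#Ш(E_K)[2]` a square; `2k ∈ {2,4,8}`
is a square only for `k = 2`.  [cite: Kramer1981, Thm. 1] [cite: SilvermanAEC2009, Thm. X.4.2, Thm. X.4.14] [cite: Cassels1962ArithmeticIV]
[cite: MazurRubin2010, Prop. 3.3] [cite: MilneADT2006, Ch. I Thm. 2.8, Thm. 4.10] -/
theorem natCard_shaTorsionBy_two_baseChange_eq_four
    (hPT : poitouTate_selmerStructure_duality_real ℚ)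
    (hEP : ∀ v : HeightOneSpectrum (𝓞 ℚ), localEulerPoincareCharacteristic (v.adicCompletion ℚ))
    (hΔ : W.Δ < 0) (h4 : Nat.card (W.selmerGroup 2) = 4) (hK : IsImaginaryQuadratic K) (hodd : Odd (discr K))
    (hH : SatisfiesHeegnerHypothesis (W.conductorNorm ℤ) K) (h2K : ((Ideal.span {(2 : ℤ)}).primesOver (𝓞 K)).ncard = 2)
    {ℓ : ℕ} [Fact ℓ.Prime] (hd : discr K = -(ℓ : ℤ))
    (Wd : WeierstrassCurve ℚ) [Wd.IsElliptic] (hWd : ∃ C : VariableChange ℚ, C • W.quadraticTwist (discr K : ℚ) = Wd)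
    (hSel : Nat.card (Wd.selmerGroup 2) = 2)
    (hL : ∀ P : (W.baseChange K).toAffine.Point, ((2 : ℕ) : ℤ) • P = 0 → P = 0)
    (hrk : (W.baseChange K).mordellWeilRank = 1)
    [Finite (AddCommGroup.primaryComponent (W.baseChange K).sha 2)] :
    Nat.card (AddSubgroup.torsionBy (W.baseChange K).sha ((2 : ℕ) : ℤ)) = 4 ∧
      Nat.card (selmerGroup (W.baseChange K) ((2 : ℕ) : ℤ)) = 8 := by
  haveI : Fact (Nat.Prime 2) := ⟨Nat.prime_two⟩
  haveI : (W.baseChange K).IsElliptic := inferInstanceAs ((W.map (algebraMap ℚ K)).IsElliptic)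
  have h2 : Module.finrank ℚ K = 2 := hK.1
  haveI : IsGalois ℚ K := isGalois_of_finrank_eq_two K h2
  have hℓ : ℓ.Prime := Fact.out
  -- the place `v₀` over `ℓ` and a non-trivial `σ₀`
  obtain ⟨v₀, hv₀⟩ : ∃ v : HeightOneSpectrum (𝓞 ℚ), ((primesEquiv v : Nat.Primes) : ℕ) = ℓ :=
    ⟨primesEquiv.symm ⟨ℓ, hℓ⟩, by rw [Equiv.apply_symm_apply]⟩
  obtain ⟨θ, hθ, hc⟩ := Literature.NumberTheory.EllipticCurves.exists_sq_eq_discr_not_mem_range K h2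
  have hσ₀ : sigmaQ K h2 hθ hc ≠ 1 := sigmaQ_ne_one K h2 hθ hc
  have hσσ : sigmaQ K h2 hθ hc * sigmaQ K h2 hθ hc = 1 := by
    have hcard : Nat.card (K ≃ₐ[ℚ] K) = 2 := by rw [IsGalois.card_aut_eq_finrank, h2]
    have h : sigmaQ K h2 hθ hc ^ Nat.card (K ≃ₐ[ℚ] K) = 1 := pow_card_eq_one'
    rwa [hcard, pow_two] at h
  -- §1 + §2: the invariants have order 4
  have hrel := (natCard_kummerRelaxed_eq_four_of_cell W hPT hEP hΔ hK hodd hH h2K hd h4 Wd hWd hSel hv₀).2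
  have hfix := natCard_fixedSelmer_eq_natCard_kummerRelaxed W K hK hΔ hH h2K hodd hd hL hσ₀ hv₀
  rw [hrel] at hfix
  -- §3: `#Sel₂(E_K) = 4k`, `k ∣ 4`
  obtain ⟨k, hk, hkd⟩ := natCard_selmerGroup_baseChange_eq_mul W K (fun w ↦ hK.2.isComplex w) hσσ
  rw [hfix] at hk hkd
  -- the descent count over `K`: `2 · #E(K)[2] · #Ш[2] = #Sel₂`
  have hpt : Nat.card (AddSubgroup.torsionBy (W.baseChange K).toAffine.Point ((2 : ℕ) : ℤ)) = 1 := by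
    have hbot : AddSubgroup.torsionBy (W.baseChange K).toAffine.Point ((2 : ℕ) : ℤ) = ⊥ :=
      (AddSubgroup.eq_bot_iff_forall _).mpr fun P hP ↦ hL P (by
        rw [natCast_zsmul]; exact AddSubgroup.torsionBy.nsmul_iff.mp hP)
    rw [hbot, AddSubgroup.card_bot]
  have hcount := (W.baseChange K).pow_mordellWeilRank_mul_natCard_torsionBy_mul_natCard_shaTorsionBy_eq (n := 2) two_ne_zero
  rw [hrk, pow_one, hpt, mul_one, hk] at hcount
  -- Cassels–Tate: `#Ш[2]` is a square
  have hsq : IsSquare (Nat.card (AddSubgroup.torsionBy (W.baseChange K).sha ((2 : ℕ) : ℤ))) := by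
    have h := GenusExact.CasselsTateNumberField.isSquare_natCard_sha_torsionBy_pow (W.baseChange K) 2 1
    rwa [pow_one] at h
  -- `k ∈ {1, 2, 4}` and `2 · square = 4k`
  have hk4 : k ∣ 2 ^ 2 := by simpa using hkd
  obtain ⟨i, hi, rfl⟩ := (Nat.dvd_prime_pow Nat.prime_two).mp hk4
  obtain ⟨s, hs⟩ := hsq
  interval_cases i
  · -- `k = 1`: `2 s² = 4`, `s² = 2`, impossible
    exfalso
    simp only [pow_zero, mul_one] at hcount
    have hs2 : s * s = 2 := by omega
    have hs' : s ≤ 2 := by nlinarith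
    interval_cases s <;> omega
  · -- `k = 2`
    simp only [pow_one] at hcount
    constructor <;> omega
  · -- `k = 4`: `2 s² = 16`, `s² = 8`, impossible
    exfalso
    have hs2 : s * s = 8 := by simp only [show (2 : ℕ) ^ 2 = 4 from rfl] at hcount; omega
    have hs' : s ≤ 3 := by nlinarith
    interval_cases s <;> omega

end Cell

end Summit.BirchSwinnertonDyer.BirchSwinnertonDyer.Theorems.GenusSupplyNarrow.KFourCell

end
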